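import Summits.Ventures.HodgeRepro2.T7SupportDominantTermTail

/-!
# The tail bound with polynomial decay and a dyadic grading (support, seat p1)

The companion of `T7SupportDominantTermTail` for POLYNOMIAL decay: weights `w N x = a x * b N x` on «orbits» `x`
with a size `size x ≥ 0`, where `‖a x‖ ≤ C (1 + size x)^{−α}`, `‖b N x‖ ≤ B (1 + size x)^{d'} ‖b N x0‖` on the
orbits carrying weight, the orbits carrying weight of size `≤ R` number at most `C' (1 + R)^β` (uniformly in the
level `N`), and the orbits `≠ x0` carrying weight at level `N` have size `≥ ρ N` with `ρ N → ∞`. If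
`α > β + d'` (`β, d' ≥ 0`), then for `N` large the orbits other than `x0` contribute at most half of the `x0`-term
(`tail_le_half_of_polynomial`). The grading is DYADIC: the bracket of `x` is `⌊log₂(1 + size x)⌋₊`, so that the
count in a bracket is `≲ 2^{kβ}` and the majorant `≲ 2^{−kα}`, and `∑_k 2^{k(β + d' − α)} < ∞` — the unit-interval
grading would require `α > β + d' + 1`.

Pure real analysis over an abstract index type; nothing here is about any geometric or automorphic object.
Blind lane: Mathlib + the HodgeRepro2 prefix only; no sorry; axioms ⊆ {propext, Classical.choice, Quot.sound}.
-/

namespace Summit.Ventures.HodgeRepro2.T7SupportDominantTermPolynomial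

open Filter Topology T7SupportDominantTermTail

variable {Orb : Type} [DecidableEq Orb]

/-- **The tail bound, polynomial decay, dyadic grading.** -/
theorem tail_le_half_of_polynomial
    (x0 : Orb) (size : Orb → ℝ) (arith : ℕ → Orb → Prop) (a : Orb → ℂ) (b : ℕ → Orb → ℂ)
    (w : ℕ → Orb → ℂ) (hw : ∀ N x, w N x = a x * b N x)
    (size_nonneg : ∀ x, 0 ≤ size x)
    (b_support : ∀ N x, b N x ≠ 0 → arith N x)
    (α β d' : ℝ) (hβ : 0 ≤ β) (hd' : 0 ≤ d') (hαβ : β + d' < α)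
    (a_bound : ∃ C : ℝ, ∀ x, ‖a x‖ ≤ C * (1 + size x) ^ (-α))
    (ρ : ℕ → ℝ) (hρ : Tendsto ρ atTop atTop)
    (size_of_arith : ∀ N x, arith N x → x ≠ x0 → ρ N ≤ size x)
    (count_bound : ∃ C' : ℝ, ∀ N (R : ℝ), 0 ≤ R →
      ∃ s : Finset Orb, (∀ x, arith N x → size x ≤ R → x ∈ s) ∧ (s.card : ℝ) ≤ C' * (1 + R) ^ β)
    (b_bound : ∃ B : ℝ, ∀ N x, arith N x → ‖b N x‖ ≤ B * (1 + size x) ^ d' * ‖b N x0‖)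
    (a_x0 : a x0 ≠ 0) :
    ∃ N₁ : ℕ, ∀ N ≥ N₁,
      (∑' x, ‖(if x = x0 then 0 else w N x)‖) ≤ (1 / 2 : ℝ) * ‖w N x0‖ := by
  classical
  obtain ⟨C, ha⟩ := a_bound
  obtain ⟨C', hcount⟩ := count_bound
  obtain ⟨B, hb⟩ := b_bound
  have hα0 : 0 < α := by linarith
  -- the dyadic size
  set sz : Orb → ℝ := fun x => Real.logb 2 (1 + size x) with hsz
  have h1x : ∀ x, (1 : ℝ) ≤ 1 + size x := fun x => by linarith [size_nonneg x]
  have h0x : ∀ x, (0 : ℝ) < 1 + size x := fun x => by linarith [size_nonneg x]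
  have hsz0 : ∀ x, 0 ≤ sz x := fun x => Real.logb_nonneg one_lt_two (h1x x)
  have hbr_le : ∀ x, (2 : ℝ) ^ ((⌊sz x⌋₊ : ℕ) : ℝ) ≤ 1 + size x := by
    intro x
    have hfl : ((⌊sz x⌋₊ : ℕ) : ℝ) ≤ sz x := Nat.floor_le (hsz0 x)
    calc (2 : ℝ) ^ ((⌊sz x⌋₊ : ℕ) : ℝ) ≤ (2 : ℝ) ^ (sz x) :=
          Real.rpow_le_rpow_of_exponent_le one_le_two hfl
      _ = 1 + size x := Real.rpow_logb two_pos (by norm_num) (h0x x)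
  have hbr_lt : ∀ x, 1 + size x < (2 : ℝ) ^ (((⌊sz x⌋₊ : ℕ) : ℝ) + 1) := by
    intro x
    have hfl : sz x < ((⌊sz x⌋₊ : ℕ) : ℝ) + 1 := Nat.lt_floor_add_one _
    calc 1 + size x = (2 : ℝ) ^ (sz x) := (Real.rpow_logb two_pos (by norm_num) (h0x x)).symm
      _ < (2 : ℝ) ^ (((⌊sz x⌋₊ : ℕ) : ℝ) + 1) := Real.rpow_lt_rpow_of_exponent_lt one_lt_two hfl
  -- the majorant and the count of a bracket
  set m : ℕ → ℝ := fun k => |C| * ((2 : ℝ) ^ (k : ℝ)) ^ (-α) * (|B| * ((2 : ℝ) ^ ((k : ℝ) + 1)) ^ d')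
    with hm
  set cnt : ℕ → ℝ := fun k => |C'| * (1 + (2 : ℝ) ^ ((k : ℝ) + 1)) ^ β with hcnt
  have hm0 : ∀ k, 0 ≤ m k := fun k => by
    simp only [hm]
    have h1 : 0 ≤ ((2 : ℝ) ^ (k : ℝ)) ^ (-α) := Real.rpow_nonneg (by positivity) _
    have h2 : 0 ≤ ((2 : ℝ) ^ ((k : ℝ) + 1)) ^ d' := Real.rpow_nonneg (by positivity) _
    positivity
  have hcnt0 : ∀ k, 0 ≤ cnt k := fun k => by
    simp only [hcnt]
    have : 0 ≤ (1 + (2 : ℝ) ^ ((k : ℝ) + 1)) ^ β := Real.rpow_nonneg (by positivity) _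
    positivity
  -- the comparison with a geometric series
  have hpow : ∀ u v : ℝ, (2 : ℝ) ^ u * (2 : ℝ) ^ v = (2 : ℝ) ^ (u + v) :=
    fun u v => (Real.rpow_add two_pos u v).symm
  set r : ℝ := (2 : ℝ) ^ (β + d' - α) with hr
  have hr0 : 0 ≤ r := Real.rpow_nonneg (by norm_num) _
  have hr1 : r < 1 := Real.rpow_lt_one_of_one_lt_of_neg one_lt_two (by linarith)
  have hcm_le : ∀ k, cnt k * m k ≤ (|C'| * |C| * |B| * (2 : ℝ) ^ (2 * β + d')) * r ^ k := by
    intro k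
    have h1 : (1 + (2 : ℝ) ^ ((k : ℝ) + 1)) ^ β ≤ ((2 : ℝ) ^ ((k : ℝ) + 2)) ^ β := by
      apply Real.rpow_le_rpow (by positivity) _ hβ
      have hge : (1 : ℝ) ≤ (2 : ℝ) ^ ((k : ℝ) + 1) :=
        Real.one_le_rpow one_le_two (by positivity)
      have h2k : (2 : ℝ) ^ ((k : ℝ) + 2) = 2 * (2 : ℝ) ^ ((k : ℝ) + 1) := by
        rw [show (k : ℝ) + 2 = ((k : ℝ) + 1) + 1 by ring, Real.rpow_add two_pos, Real.rpow_one]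
        ring
      calc 1 + (2 : ℝ) ^ ((k : ℝ) + 1) ≤ (2 : ℝ) ^ ((k : ℝ) + 1) + (2 : ℝ) ^ ((k : ℝ) + 1) := by
            linarith
        _ = (2 : ℝ) ^ ((k : ℝ) + 2) := by rw [h2k]; ring
    have e1 : ((2 : ℝ) ^ ((k : ℝ) + 2)) ^ β = (2 : ℝ) ^ (((k : ℝ) + 2) * β) :=
      (Real.rpow_mul (by norm_num) _ _).symm
    have e2 : ((2 : ℝ) ^ (k : ℝ)) ^ (-α) = (2 : ℝ) ^ ((k : ℝ) * (-α)) :=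
      (Real.rpow_mul (by norm_num) _ _).symm
    have e3 : ((2 : ℝ) ^ ((k : ℝ) + 1)) ^ d' = (2 : ℝ) ^ (((k : ℝ) + 1) * d') :=
      (Real.rpow_mul (by norm_num) _ _).symm
    have e4 : r ^ k = (2 : ℝ) ^ ((β + d' - α) * k) := by
      rw [hr, ← Real.rpow_natCast, ← Real.rpow_mul (by norm_num)]
    have hm_nonneg : 0 ≤ |C| * ((2 : ℝ) ^ (k : ℝ)) ^ (-α) * (|B| * ((2 : ℝ) ^ ((k : ℝ) + 1)) ^ d') :=
      hm0 k
    calc cnt k * m k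
        = |C'| * (1 + (2 : ℝ) ^ ((k : ℝ) + 1)) ^ β *
            (|C| * ((2 : ℝ) ^ (k : ℝ)) ^ (-α) * (|B| * ((2 : ℝ) ^ ((k : ℝ) + 1)) ^ d')) := rfl
      _ ≤ |C'| * ((2 : ℝ) ^ ((k : ℝ) + 2)) ^ β *
            (|C| * ((2 : ℝ) ^ (k : ℝ)) ^ (-α) * (|B| * ((2 : ℝ) ^ ((k : ℝ) + 1)) ^ d')) := by
          gcongr
      _ = (|C'| * |C| * |B|) * ((2 : ℝ) ^ (((k : ℝ) + 2) * β) * (2 : ℝ) ^ ((k : ℝ) * (-α)) *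
            (2 : ℝ) ^ (((k : ℝ) + 1) * d')) := by
          rw [e1, e2, e3]; ring
      _ = (|C'| * |C| * |B|) *
            (2 : ℝ) ^ (((k : ℝ) + 2) * β + (k : ℝ) * (-α) + ((k : ℝ) + 1) * d') := by
          rw [hpow, hpow]
      _ = (|C'| * |C| * |B|) * ((2 : ℝ) ^ (2 * β + d') * (2 : ℝ) ^ ((β + d' - α) * k)) := by
          rw [hpow]
          congr 2
          ring
      _ = (|C'| * |C| * |B| * (2 : ℝ) ^ (2 * β + d')) * r ^ k := by
          rw [e4]; ring
  have hcm0 : ∀ k, 0 ≤ cnt k * m k := fun k => mul_nonneg (hcnt0 k) (hm0 k)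
  have hsum : Summable fun k => cnt k * m k :=
    Summable.of_nonneg_of_le hcm0 hcm_le ((summable_geometric_of_lt_one hr0 hr1).mul_left _)
  have htail : Tendsto (fun K => ∑' j, cnt (j + K) * m (j + K)) atTop (𝓝 0) :=
    tendsto_sum_nat_add fun k => cnt k * m k
  have hε : 0 < (1 / 2 : ℝ) * ‖a x0‖ := by
    have : 0 < ‖a x0‖ := norm_pos_iff.2 a_x0
    positivity
  obtain ⟨K, hK⟩ : ∃ K : ℕ, ∀ K' ≥ K, ∑' j, cnt (j + K') * m (j + K') < (1 / 2 : ℝ) * ‖a x0‖ :=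
    eventually_atTop.1 ((tendsto_order.1 htail).2 _ hε)
  -- the threshold: `log₂(1 + ρ N) → ∞`
  have hρ' : Tendsto (fun N => Real.logb 2 (1 + ρ N)) atTop atTop :=
    (Real.tendsto_logb_atTop one_lt_two).comp (tendsto_atTop_add_const_left _ _ hρ)
  obtain ⟨N₁, hN₁⟩ : ∃ N₁ : ℕ, ∀ N ≥ N₁, (K : ℝ) ≤ Real.logb 2 (1 + ρ N) :=
    eventually_atTop.1 (tendsto_atTop.1 hρ' (K : ℝ))
  obtain ⟨N₂, hN₂⟩ : ∃ N₂ : ℕ, ∀ N ≥ N₂, (1 : ℝ) ≤ ρ N :=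
    eventually_atTop.1 (tendsto_atTop.1 hρ 1)
  refine ⟨max N₁ N₂, fun N hN => ?_⟩
  have hN1 : N₁ ≤ N := le_trans (le_max_left _ _) hN
  have hN2 : N₂ ≤ N := le_trans (le_max_right _ _) hN
  have hρN : (1 : ℝ) ≤ ρ N := hN₂ N hN2
  -- the majorant on an orbit carrying weight
  have hmaj : ∀ x, arith N x → ‖a x‖ * ‖b N x‖ ≤ m ⌊sz x⌋₊ * ‖b N x0‖ := by
    intro x hx
    have hneg : -α ≤ 0 := by linarith
    have hax : ‖a x‖ ≤ |C| * ((2 : ℝ) ^ ((⌊sz x⌋₊ : ℕ) : ℝ)) ^ (-α) := by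
      calc ‖a x‖ ≤ C * (1 + size x) ^ (-α) := ha x
        _ ≤ |C| * (1 + size x) ^ (-α) :=
          mul_le_mul_of_nonneg_right (le_abs_self C) (Real.rpow_nonneg (h0x x).le _)
        _ ≤ |C| * ((2 : ℝ) ^ ((⌊sz x⌋₊ : ℕ) : ℝ)) ^ (-α) :=
          mul_le_mul_of_nonneg_left
            (Real.rpow_le_rpow_of_nonpos (by positivity) (hbr_le x) hneg) (abs_nonneg C)
    have hbx : ‖b N x‖ ≤ |B| * ((2 : ℝ) ^ (((⌊sz x⌋₊ : ℕ) : ℝ) + 1)) ^ d' * ‖b N x0‖ := by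
      have hXY : (1 + size x) ^ d' ≤ ((2 : ℝ) ^ (((⌊sz x⌋₊ : ℕ) : ℝ) + 1)) ^ d' :=
        Real.rpow_le_rpow (h0x x).le (hbr_lt x).le hd'
      calc ‖b N x‖ ≤ B * (1 + size x) ^ d' * ‖b N x0‖ := hb N x hx
        _ ≤ |B| * ((2 : ℝ) ^ (((⌊sz x⌋₊ : ℕ) : ℝ) + 1)) ^ d' * ‖b N x0‖ :=
          mul_le_mul_of_nonneg_right
            (mul_le_mul (le_abs_self B) hXY (Real.rpow_nonneg (h0x x).le _) (abs_nonneg B))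
            (norm_nonneg _)
    calc ‖a x‖ * ‖b N x‖
        ≤ (|C| * ((2 : ℝ) ^ ((⌊sz x⌋₊ : ℕ) : ℝ)) ^ (-α)) *
            (|B| * ((2 : ℝ) ^ (((⌊sz x⌋₊ : ℕ) : ℝ) + 1)) ^ d' * ‖b N x0‖) :=
          mul_le_mul hax hbx (norm_nonneg _) (by positivity)
      _ = m ⌊sz x⌋₊ * ‖b N x0‖ := by simp only [hm]; ring
  -- the count of a bracket
  have hcntk : ∀ k : ℕ, ∃ t : Finset Orb,
      (∀ x, arith N x → ⌊sz x⌋₊ = k → x ∈ t) ∧ (t.card : ℝ) ≤ cnt k := by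
    intro k
    obtain ⟨t, htmem, htcard⟩ := hcount N ((2 : ℝ) ^ ((k : ℝ) + 1)) (by positivity)
    refine ⟨t, fun x hx hk => htmem x hx ?_, ?_⟩
    · have := hbr_lt x
      rw [hk] at this
      linarith
    · calc (t.card : ℝ) ≤ C' * (1 + (2 : ℝ) ^ ((k : ℝ) + 1)) ^ β := htcard
        _ ≤ |C'| * (1 + (2 : ℝ) ^ ((k : ℝ) + 1)) ^ β := by
          gcongr
          exact le_abs_self C'
  -- the bracket threshold
  have hKx : ∀ x, arith N x → x ≠ x0 → K ≤ ⌊sz x⌋₊ := by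
    intro x hx hx0
    apply Nat.le_floor
    calc (K : ℝ) ≤ Real.logb 2 (1 + ρ N) := hN₁ N hN1
      _ ≤ sz x := by
        apply (Real.logb_le_logb one_lt_two (by linarith) (h0x x)).2
        linarith [size_of_arith N x hx hx0]
  calc (∑' x, ‖(if x = x0 then 0 else w N x)‖)
      ≤ ‖b N x0‖ * ∑' j, cnt (j + K) * m (j + K) :=
        tail_le_shifted_tsum N x0 sz arith a b w hw (b_support N) m cnt hm0 hcnt0 hmaj hcntk K hKx hsum
    _ ≤ ‖b N x0‖ * ((1 / 2 : ℝ) * ‖a x0‖) := by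
        gcongr
        exact (hK K le_rfl).le
    _ = (1 / 2 : ℝ) * ‖w N x0‖ := by rw [hw, norm_mul]; ring

end Summit.Ventures.HodgeRepro2.T7SupportDominantTermPolynomial
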